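import Summits.BirchSwinnertonDyer.BirchSwinnertonDyer.Theorems.TeichmullerTwistDescentGE11OfBorelInputs
import Summits.BirchSwinnertonDyer.BirchSwinnertonDyer.Theorems.TeichmullerTwistDescentTameExponent
import HarnessLib

/-!
# Route `TeichmullerTwistDescent`, crux K `TwistedPeriodLatticeSaturation` (stmt-BirchSwinnertonDyer-25368):
# K from modularity, a NONZERO EQUIVARIANT MAP TO THE TAME PRINCIPAL SERIES (I1⁰) and the weight exclusion (W‴);
# (I1⁰) ⟺ (I1‴)

Cell `pub/bsd-wall` (D-0145 line route-BirchSwinnertonDyer-TeichmullerTwistDescent, OPEN rev 7), seat `bsd-line-ttd-p1`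
(prover 1/2, g26).  THEOREMS ONLY (no definition, no named fact, no `sorry`); `--supports stmt-BirchSwinnertonDyer-25368`.
BSD is not proved by this file; K is NOT proved by this file (it stays CONDITIONAL); nothing here closes an item.

WHAT.  After g25 (`KOfBorelEigenfunctional`: K ⟸ `exists_isNewformOf` ∧ (I1‴) ∧ (W‴)) the automorphic input (I1‴)
`NonzeroBorelEigenfunctional` still carried the exponent inequalities `0 < b`, `2b < p − 1` and the Borel bookkeeping.  With
`TeichmullerTwistDescentTameExponent` (g26: the inequalities follow from the prefix) the input shrinks to its representation-
theoretic core (I1⁰) `TamePrincipalSeriesFunctional` (`TeichmullerTwistDescentCarrierDefs`, appended g26): «there is a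
NONZERO `GL₂(𝔽_p)`-equivariant `ℤ_p`-linear map from the K-line lattice `Λ_Q(f_D)` to the Bruhat model
`coordRep(ω̃^{p−1−b}, ω̃ᵇ)` of the tame principal series», i.e. `Hom_G(Λ_Q(f_W), Ind(ω̃^{−b} ⊗ ω̃ᵇ)) ≠ 0`.

* `exists_coordRep_apply_none_ne_zero` — a nonzero vector of the Bruhat model has a nonzero identity-coset coordinate at
  some translate (the function it represents is nonzero somewhere);
* **`nonzeroBorelEigenfunctional_of_tamePrincipalSeriesFunctional : I1⁰ → I1‴`** — `λ(z) := Ψ(Π z)(1)` is a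
  `(B, ω̃^{p−1−b} ⊗ ω̃ᵇ)`-eigenfunctional killing `ker(spreadPeriod f_D)`, nonzero at a translate of a witness of `Ψ ≠ 0`;
  the inequalities come from `TameExponent.tameExponent_bounds`;
* **`tamePrincipalSeriesFunctional_of_nonzeroBorelEigenfunctional : I1‴ → I1⁰`** — Frobenius reciprocity
  (`frobeniusCoord`) rebuilds an equivariant `Ψ₀ : C → L` with identity coordinate `λ`, which kills `ker(spreadPeriod)`
  and descends to `Λ_Q(f_D) = C / ker`; so **(I1⁰) ⟺ (I1‴)** (`tamePrincipalSeriesFunctional_iff`);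
* **`twistedPeriodLatticeSaturation_of_principalSeries_of_noEtaleWeightEigenQuotient (hnf) (hPS) (hW) : K`** (route decl
  verbatim) and the GE11 certificate `ordinaryLowValuationOptimalManinUnitGeEleven_of_principalSeries_inputs`.

STATE OF THE K-LINE (g26): K ⟸ `exists_isNewformOf` ∧ (I1⁰) ∧ (W‴): (I1⁰) = the tame principal series `Ind(ω̃^{−b} ⊗ ω̃ᵇ)`
OCCURS in the `f_W`-part of the full-level homology [local Langlands / Carayol at `p` for the potentially ordinary curve —
inertia acts through `μ_e`, `e ∣ p − 1` — plus Eichler–Shimura at level `K(p)K₀(M)`]; (W‴) = `Sym^{2b} ⊗ det^{−b}` is NOT a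
Hecke-eigen quotient of the carrier [Ash–Stevens 1986 Thm. 3.5 + Edixhoven 1992 Thm. 4.5 + the tame inertia shape
`ρ̄_W|I_p ∼ (ω^{1−b} ∗; 0 ωᵇ)` of Kraus 1997 Prop. 1].  [cite: SerreLinearRepresentations1977, §7.2 Prop. 21]
[cite: Bump1997, §4.1 Eq. (1.6)–(1.7)] [cite: AshStevens1986, §1 (1.2)–(1.4)] [cite: EdixhovenManin1991, §4]
-/

set_option autoImplicit false
-- single-conjunct summit: `Summit.BirchSwinnertonDyer.BirchSwinnertonDyer.…` repeats the name by design
set_option linter.dupNamespace false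

noncomputable section

open scoped Pointwise MatrixGroups TensorProduct

open Function CongruenceSubgroup
open Literature.RepresentationTheory.FiniteGroups Literature.RepresentationTheory.FiniteGroups.GL2
  Literature.NumberTheory.EllipticCurves.ModularForms
open Literature.NumberTheory.EllipticCurves (Kato2004.teichmullerChar)
open Literature.NumberTheory.ModularSymbols Literature.NumberTheory.ModularSymbols.FullLevel
open Literature.Algebra.Homology

namespace Summit.BirchSwinnertonDyer.BirchSwinnertonDyer.Theorems.TeichmullerTwistDescent

open WeierstrassCurve Literature.NumberTheory.EllipticCurves
open Summit.BirchSwinnertonDyer.BirchSwinnertonDyer.Theses.TeichmullerTwistDescent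

namespace KOfPrincipalSeriesFunctional

/-- A nonzero vector of the Bruhat-coordinate model `coordRep χ₁ χ₂` of `Ind(χ₁ ⊗ χ₂)` has a NONZERO identity-coset
coordinate at some right translate: the function `φ` it represents is nonzero at some `g`, and `(g·v)(1) = φ(g)`.
[cite: Bump1997, §4.1 Eq. (1.6)–(1.7)] -/
theorem exists_coordRep_apply_none_ne_zero {F : Type} [Field F] [DecidableEq F] {R : Type} [CommRing R]
    (χ₁ χ₂ : Fˣ →* Rˣ) {v : Option F → R} (hv : v ≠ 0) : ∃ g : GL (Fin 2) F, coordRep χ₁ χ₂ g v none ≠ 0 := by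
  by_contra h
  push Not at h
  apply hv
  have hφ : ((bruhatLift χ₁ χ₂ v : Representation.coindV (borel F).subtype (scalarRep (borelCharacter F χ₁ χ₂))) :
      GL (Fin 2) F → R) = 0 := by
    funext g
    have hg := h g
    rwa [coordRep_apply, bruhatEval_none, principalSeriesRep_apply_coe, one_mul] at hg
  have h0 : bruhatLift χ₁ χ₂ v = 0 := Subtype.ext hφ
  rw [← bruhatEval_bruhatLift χ₁ χ₂ v, h0, map_zero]

/-- **(I1⁰) ⟹ (I1‴)**: a nonzero equivariant `Ψ : Λ_Q(f_D) → coordRep(ω̃^{p−1−b}, ω̃ᵇ)` yields a nonzero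
`(B, ω̃^{p−1−b} ⊗ ω̃ᵇ)`-eigenfunctional on the carrier killing `ker(spreadPeriod f_D)` — the identity-coset coordinate
`λ(z) := Ψ(Π z)(1)`, nonzero at a translate of a witness of `Ψ ≠ 0`; the inequalities `0 < b`, `2b < p − 1` are supplied by
the prefix (`TameExponent.tameExponent_bounds`).  BSD is not proved by this.
[cite: SerreLinearRepresentations1977, §7.2 Prop. 21] [cite: Bump1997, §4.1 Eq. (1.6)–(1.7)] -/
theorem nonzeroBorelEigenfunctional_of_tamePrincipalSeriesFunctional (hPS : TamePrincipalSeriesFunctional) :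
    NonzeroBorelEigenfunctional := by
  intro p M _ _ _ hpM _ _ W _ _ hN D hp11 hadd hirr hGo hV4
  obtain ⟨Ψ, hΨ, hΨ0⟩ := hPS p M hpM W hN D hp11 hadd hirr hGo hV4
  obtain ⟨hb, hb2⟩ := TameExponent.tameExponent_bounds W p hp11 hadd hGo hV4
  -- a witness of `Ψ ≠ 0`, written as a spread, and a translate with nonzero identity coordinate
  obtain ⟨F, hF⟩ : ∃ F, Ψ F ≠ 0 := by
    by_contra h
    push Not at h
    exact hΨ0 (LinearMap.ext fun F => by rw [h F, LinearMap.zero_apply])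
  obtain ⟨z₀, hz₀⟩ : ∃ z, spreadElt ℤ_[p] p M hpM D.f z = F := by
    obtain ⟨z, hz⟩ := F.2
    exact ⟨z, Subtype.ext hz⟩
  subst hz₀
  obtain ⟨g, hg⟩ := exists_coordRep_apply_none_ne_zero
    (Kato2004.teichmullerChar p ^ (p - 1 - tameExponent p W)) (Kato2004.teichmullerChar p ^ tameExponent p W) hF
  -- `λ z := Ψ(Π z)(1)`
  let ev : (Option (ZMod p) → ℤ_[p]) →ₗ[ℤ_[p]] ℤ_[p] := LinearMap.proj none
  let lam : H1carrier ℤ_[p] p M →ₗ[ℤ_[p]] ℤ_[p] :=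
    ev.comp (Ψ.comp (LinearMap.rangeRestrict (spreadPeriod ℤ_[p] p M hpM D.f)))
  have hlam : ∀ z, lam z = Ψ (spreadElt ℤ_[p] p M hpM D.f z) none := fun z => rfl
  refine ⟨hb, hb2, lam, ?_, ?_, ?_⟩
  · intro h0
    apply hg
    have h1 : lam (H1carrierRep ℤ_[p] p M g z₀) = 0 := by rw [h0, LinearMap.zero_apply]
    rwa [hlam, spreadElt_H1carrierRep, hΨ _ g] at h1
  · intro β z
    rw [hlam, hlam, spreadElt_H1carrierRep, hΨ _ (β : GL (Fin 2) (ZMod p)),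
      KOfBorelEigenfunctional.coordRep_borel_apply_none]
  · intro z hz
    have : spreadElt ℤ_[p] p M hpM D.f z = 0 := Subtype.ext (by rw [coe_spreadElt, hz]; rfl)
    rw [hlam, this, map_zero, Pi.zero_apply]

/-- **(I1‴) ⟹ (I1⁰)**: Frobenius reciprocity (`frobeniusCoord`) turns a nonzero Borel eigenfunctional `λ` on the carrier
killing `ker(spreadPeriod f_D)` into a nonzero equivariant `Ψ₀ : C → L` with identity coordinate `λ`; `Ψ₀` kills
`ker(spreadPeriod)` (a translation-stable set on which `λ` vanishes) and descends to `Λ_Q(f_D) = C / ker(spreadPeriod)`.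
BSD is not proved by this. [cite: SerreLinearRepresentations1977, §7.2 Prop. 21] [cite: AshStevens1986, §1 (1.2)–(1.3)] -/
theorem tamePrincipalSeriesFunctional_of_nonzeroBorelEigenfunctional (hB : NonzeroBorelEigenfunctional) :
    TamePrincipalSeriesFunctional := by
  intro p M _ _ _ hpM _ _ W _ _ hN D hp11 hadd hirr hGo hV4
  obtain ⟨-, -, lam, hlam0, hlamB, hlamK⟩ := hB p M hpM W hN D hp11 hadd hirr hGo hV4
  set b := tameExponent p W with hbdef
  -- Frobenius reciprocity: the equivariant map `Ψ₀ : C → L`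
  let Ψ₀ : H1carrier ℤ_[p] p M →ₗ[ℤ_[p]] (Option (ZMod p) → ℤ_[p]) :=
    frobeniusCoord (Kato2004.teichmullerChar p ^ (p - 1 - b)) (Kato2004.teichmullerChar p ^ b)
      (H1carrierRep ℤ_[p] p M) lam hlamB
  have hΨ₀G : ∀ (g : GL (Fin 2) (ZMod p)) (z : H1carrier ℤ_[p] p M),
      Ψ₀ (H1carrierRep ℤ_[p] p M g z) =
        coordRep (Kato2004.teichmullerChar p ^ (p - 1 - b)) (Kato2004.teichmullerChar p ^ b) g (Ψ₀ z) :=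
    fun g z => frobeniusCoord_apply_rep _ _ _ _ hlamB g z
  have hΨ₀K : ∀ z : H1carrier ℤ_[p] p M, spreadPeriod ℤ_[p] p M hpM D.f z = 0 → Ψ₀ z = 0 := by
    intro z hz
    refine frobeniusCoord_eq_zero_of _ _ _ _ hlamB (S := {z | spreadPeriod ℤ_[p] p M hpM D.f z = 0}) ?_ hlamK hz
    intro g w hw
    change spreadPeriod ℤ_[p] p M hpM D.f (H1carrierRep ℤ_[p] p M g w) = 0
    have h := congrArg Subtype.val (spreadElt_H1carrierRep ℤ_[p] p M hpM D.f g w)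
    rw [coe_spreadElt] at h
    rw [h]
    change funTranslate p g (spreadPeriod ℤ_[p] p M hpM D.f w) = 0
    rw [show spreadPeriod ℤ_[p] p M hpM D.f w = 0 from hw]
    rfl
  -- descend `Ψ₀` to `Λ_Q(f_D) = C / ker(spreadPeriod)`
  have hkerle : LinearMap.ker (spreadPeriod ℤ_[p] p M hpM D.f) ≤ LinearMap.ker Ψ₀ :=
    fun z hz => hΨ₀K z hz
  let Ψ : spreadLattice ℤ_[p] p M hpM D.f →ₗ[ℤ_[p]] (Option (ZMod p) → ℤ_[p]) :=
    ((LinearMap.ker (spreadPeriod ℤ_[p] p M hpM D.f)).liftQ Ψ₀ hkerle).comp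
      (spreadPeriod ℤ_[p] p M hpM D.f).quotKerEquivRange.symm.toLinearMap
  have hΨ : ∀ z, Ψ (spreadElt ℤ_[p] p M hpM D.f z) = Ψ₀ z := by
    intro z
    have hq : (spreadPeriod ℤ_[p] p M hpM D.f).quotKerEquivRange.symm (spreadElt ℤ_[p] p M hpM D.f z) =
        Submodule.Quotient.mk z := by
      rw [LinearEquiv.symm_apply_eq]
      exact Subtype.ext (by rw [LinearMap.quotKerEquivRange_apply_mk, coe_spreadElt])
    change (LinearMap.ker (spreadPeriod ℤ_[p] p M hpM D.f)).liftQ Ψ₀ hkerle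
      ((spreadPeriod ℤ_[p] p M hpM D.f).quotKerEquivRange.symm (spreadElt ℤ_[p] p M hpM D.f z)) = Ψ₀ z
    rw [hq, Submodule.liftQ_apply]
  refine ⟨Ψ, ?_, ?_⟩
  · intro F g
    obtain ⟨z, hz⟩ : ∃ z, spreadElt ℤ_[p] p M hpM D.f z = F := by
      obtain ⟨z, hz⟩ := F.2
      exact ⟨z, Subtype.ext hz⟩
    subst hz
    rw [← spreadElt_H1carrierRep, hΨ, hΨ, hΨ₀G]
  · -- nonzero: the identity coordinate of `Ψ₀ z` is `λ z`
    intro h0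
    apply hlam0
    ext z
    have h1 : Ψ (spreadElt ℤ_[p] p M hpM D.f z) none = 0 := by rw [h0, LinearMap.zero_apply, Pi.zero_apply]
    rw [hΨ, frobeniusCoord_apply_none] at h1
    rw [h1, LinearMap.zero_apply]

/-- **(I1⁰) ⟺ (I1‴)**: the two automorphic inputs are equivalent. BSD is not proved by this.
[cite: SerreLinearRepresentations1977, §7.2 Prop. 21] -/
theorem tamePrincipalSeriesFunctional_iff : TamePrincipalSeriesFunctional ↔ NonzeroBorelEigenfunctional :=
  ⟨nonzeroBorelEigenfunctional_of_tamePrincipalSeriesFunctional, tamePrincipalSeriesFunctional_of_nonzeroBorelEigenfunctional⟩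

/-- **(I1″) ⟹ (I1⁰)**: the rational functional of finite index is in particular nonzero.  BSD is not proved by this.
[cite: AshStevens1986, §1 (1.2)–(1.3)] -/
theorem tamePrincipalSeriesFunctional_of_rational (hrat : RationalTameTypeCarrierFunctional) :
    TamePrincipalSeriesFunctional :=
  tamePrincipalSeriesFunctional_of_nonzeroBorelEigenfunctional
    (KOfBorelEigenfunctional.nonzeroBorelEigenfunctional_of_rational hrat)

/-- **`IntegralTameTypeCarrierFunctional` from (I1⁰) and (W‴).**  BSD is not proved by this.
[cite: SerreLinearRepresentations1977, §7.2 Prop. 21] [cite: EmertonGeeSavitt2015, Lemma 4.1.1] -/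
theorem integralTameTypeCarrierFunctional_of_principalSeries_of_noEtaleWeightEigenQuotient
    (hPS : TamePrincipalSeriesFunctional) (hW : NoEtaleWeightEigenQuotient) : IntegralTameTypeCarrierFunctional :=
  KOfBorelEigenfunctional.integralTameTypeCarrierFunctional_of_borel_of_noEtaleWeightEigenQuotient
    (nonzeroBorelEigenfunctional_of_tamePrincipalSeriesFunctional hPS) hW

/-- **K from modularity, a nonzero equivariant map to the tame principal series (I1⁰) and the Ash–Stevens weight exclusion
(W‴).**  Conclusion = the route decl `TwistedPeriodLatticeSaturation` VERBATIM; BSD is not proved by this; K is proved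
CONDITIONALLY on the three named hypotheses. [cite: EdixhovenManin1991, §4] [cite: SerreLinearRepresentations1977, §7.2 Prop. 21] -/
theorem twistedPeriodLatticeSaturation_of_principalSeries_of_noEtaleWeightEigenQuotient (hnf : exists_isNewformOf)
    (hPS : TamePrincipalSeriesFunctional) (hW : NoEtaleWeightEigenQuotient) : TwistedPeriodLatticeSaturation :=
  KOfBorelEigenfunctional.twistedPeriodLatticeSaturation_of_borel_of_noEtaleWeightEigenQuotient hnf
    (nonzeroBorelEigenfunctional_of_tamePrincipalSeriesFunctional hPS) hW

/-- **GE11 from its final named inputs (g26 form).**  `OrdinaryLowValuationOptimalManinUnitGeEleven` (route decl verbatim)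
from modularity, Edixhoven's Kodaira-type theorem, (I1⁰) and (W‴).  BSD is not proved by this; GE11 is proved CONDITIONALLY
on the four named hypotheses. [cite: EdixhovenManin1991, §4 and Thm. 3] [cite: Stevens1989, Lemma (5.2)] -/
theorem ordinaryLowValuationOptimalManinUnitGeEleven_of_principalSeries_inputs (hnf : exists_isNewformOf)
    (hEdix : edixhoven_not_dvd_maninConstant_of_kodairaSymbol_ne)
    (hPS : TamePrincipalSeriesFunctional) (hW : NoEtaleWeightEigenQuotient) :
    OrdinaryLowValuationOptimalManinUnitGeEleven :=
  KOfBorelEigenfunctional.ordinaryLowValuationOptimalManinUnitGeEleven_of_borel_inputs hnf hEdix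
    (nonzeroBorelEigenfunctional_of_tamePrincipalSeriesFunctional hPS) hW

end KOfPrincipalSeriesFunctional

end Summit.BirchSwinnertonDyer.BirchSwinnertonDyer.Theorems.TeichmullerTwistDescent
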